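/-
Cell pub-hodgecm2 (COR-CM = Hodge ladder stage 2), seat b12 (prover-pub-hodgecm2-b12-0), 2026-08-20.
NEW file (not a port): the `ModelAxioms` field `Fact_weilLine_hodge` is DERIVED, for every geometric universe, from three
other fields of the record. Tree target `Summits/HodgeConjecture/CorCM/Geometry/WeilLineHodge.lean`; theorems only.
-/
import Summits.HodgeConjecture.CorCM.Geometry.Facts
import Summits.HodgeConjecture.CorCM.CM.Lemmas
import HarnessLib

/-!
# rfwf Lemma 1.2: the Weil line of the corner product of a face consists of Hodge classes

For a geometric universe `U` (`Summit.HodgeConjecture.CorCM.Universe`) the named fact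
`Universe.Fact_weilLine_hodge` — "for every CM field `K` and every rank-four face `f`, the Weil line
`W_K(P(f)) ⊂ H⁴(P(f), ℚ)` of the product `P(f) = ∏ᵢ A_{Φᵢ}` of the four corners lies in the rational Hodge
classes of type `(2,2)`" (rfwf v3 Lemma 1.2 `lem:hodge22`) — is a CONSEQUENCE of three other fields of
`Universe.ModelAxioms`:

* `Fact_pull_hodge` (pull-backs respect the Hodge filtration),
* `Fact_cup2_hodge` (`F^p H^k ∪ F^q H^k ⊆ F^{p+q} H^{2k}`),
* `Fact_alphaLine` (the CM-type condition `H^{1,0}(A_{(K,Φ)})_σ = H¹(A_{(K,Φ)}, ℂ)_σ` for `σ ∈ Φ`, `= 0` for `σ ∉ Φ`).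

Proof (as in print, and as in the stage-1 package's toy witness `HodgeCM.Model.Toy.Weil.span_weilGenerators_le_F`,
where however `F⁰ H¹ = H¹` was available by construction): a `σ`-eigenform `y ∈ H¹(A_{(K,Φ)}, ℂ)_σ` lies in
`F^{1_Φ(σ)} H¹` — for `σ ∈ Φ` because the eigenline is `H^{1,0}_σ ⊆ F¹`; for `σ ∉ Φ` because `conj y` is a
`σ̄`-eigenform, `σ̄ ∈ Φ` (`Φ` is a CM type), so `conj y ∈ H^{1,0}` and `y ∈ H^{0,1} ⊆ F⁰` (`eigenLine_le_F`).  Hence a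
Weil generator `pr₀^*y₀ ∪ pr₁^*y₁ ∪ pr₂^*y₂ ∪ pr₃^*y₃` with all `yᵢ` of character `σ` lies in
`F^{Σᵢ 1_{Φᵢ}(σ)} H⁴(P) = F² H⁴(P)` by `Fact_pull_hodge`, `Fact_cup2_hodge` and the corner identity `Σᵢ 1_{Φᵢ} = 2`
(`sumTwo_corner`, `Summits/HodgeConjecture/CorCM/CM/Lemmas.lean`); the complex span of the generators is then inside
`F² H⁴(P)`, and a rational class whose complexification lies there is a Hodge class by definition
(`HodgeStructure.mem_hodgeClasses_iff`).

Consequence for the cell: the 28-field record `U.ModelAxioms` consumed by `Assembly.hc_cm_of_periodThmF` needs no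
separate model proof of its field `weilLine_hodge` — `Universe.weilLine_hodge_of_facts` supplies it from `pull_hodge`,
`cup2_hodge`, `alphaLine` (all three kernel for the Picard–CM model universe: stage-1 `universeOf_modelAxiomsPerL`,
`universeOf_fact_alphaLine`).
-/

noncomputable section

open scoped TensorProduct

namespace Summit.HodgeConjecture.CorCM

open Literature.AlgebraicGeometry.Motives (CMType)
open Literature.AlgebraicGeometry.Motives.HodgeStructure (conj ofRat conj_conj conj_mem_piece piece_le_F
  mem_hodgeClasses_iff mem_complexConj)
open Literature.AlgebraicGeometry.Motives.HodgeStructure.EndAction (eigenPiece_le_piece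
  complexConj_eigenspace_baseChange)
open NumberField.ComplexEmbedding (conjugate involutive_conjugate conjugate_coe_eq)

namespace Universe

variable (U : Universe)

/-- For a CM type `Φ`, an embedding off `Φ` has its conjugate in `Φ` (`Φ ⊔ Φ̄ = Hom(K, ℂ)`). [folklore] -/
theorem conjugate_mem_of_not_mem {K : Type} [Field K] (Φ : CMType K) {σ : K →+* ℂ} (hσ : σ ∉ Φ.1) :
    conjugate σ ∈ Φ.1 := by
  by_contra h
  exact hσ ((Φ.2 σ).2 h)

/-- Complex conjugation carries the `σ`-eigenline of `H¹(A_{(K,Φ)}, ℂ)` to the `σ̄`-eigenline: the CM action is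
rational, so `conj ((ι e)_ℂ y) = (ι e)_ℂ (conj y)`, and `conj (σ(e) y) = σ̄(e) conj y`
(Deligne, LNM 900 §4; tree `HodgeStructure.EndAction.complexConj_eigenspace_baseChange`). [folklore] -/
theorem conj_mem_eigenLine (K : CMField) (Φ : CMType K) (σ : K →+* ℂ) {y : U.CohC (U.cmAV K Φ) 1}
    (hy : y ∈ U.eigenLine K Φ σ) : conj y ∈ U.eigenLine K Φ (conjugate σ) := by
  simp only [eigenLine, Submodule.mem_iInf] at hy ⊢
  intro e
  rw [← mem_complexConj, complexConj_eigenspace_baseChange, conjugate_coe_eq, starRingEnd_self_apply]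
  exact hy e

/-- **A `σ`-eigenform lies in `F^{1_Φ(σ)} H¹(A_{(K,Φ)})`** (the CM-type condition `Fact_alphaLine`): for `σ ∈ Φ` the
eigenline is the holomorphic eigenline `H^{1,0}_σ ⊆ F¹`; for `σ ∉ Φ` its conjugate is the holomorphic
`σ̄`-eigenline, so the eigenline lies in `H^{0,1} ⊆ F⁰` (Shimura–Taniyama; Deligne LNM 900 §4). [folklore] -/
theorem eigenLine_le_F (h₁₃ : U.Fact_alphaLine) (K : CMField) (Φ : CMType K) (σ : K →+* ℂ) :
    U.eigenLine K Φ σ ≤ (U.hodge (U.cmAV K Φ) 1).F (ind Φ σ) := by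
  intro y hy
  by_cases hσ : σ ∈ Φ.1
  · rw [ind_of_mem hσ]
    have hy' : y ∈ U.alphaLine K Φ σ := by rw [(h₁₃ K Φ σ).1 hσ]; exact hy
    exact piece_le_F _ 1 0 (eigenPiece_le_piece _ σ 1 0 hy')
  · rw [ind_of_not_mem hσ]
    have hσ' : conjugate σ ∈ Φ.1 := conjugate_mem_of_not_mem Φ hσ
    have h1 : conj y ∈ U.alphaLine K Φ (conjugate σ) := by
      rw [(h₁₃ K Φ (conjugate σ)).1 hσ']
      exact U.conj_mem_eigenLine K Φ σ hy
    have h2 : conj y ∈ (U.hodge (U.cmAV K Φ) 1).piece 1 0 := eigenPiece_le_piece _ _ 1 0 h1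
    have h3 : y ∈ (U.hodge (U.cmAV K Φ) 1).piece 0 1 := by
      simpa only [conj_conj] using conj_mem_piece _ h2
    exact piece_le_F _ 0 1 h3

/-- The pull-back `prᵢ^* yᵢ ∈ H¹(P, ℂ)` of a `σ`-eigenform on the `i`-th corner lies in `F^{1_{Φᵢ}(σ)} H¹(P)`
(`eigenLine_le_F` + `Fact_pull_hodge`). [folklore] -/
theorem pullC_pr4_mem_F (h₃ : U.Fact_pull_hodge) (h₁₃ : U.Fact_alphaLine) (K : CMField)
    (Φ : Fin 4 → CMType K) (σ : K →+* ℂ) (i : Fin 4) {y : U.CohC (U.cmAV K (Φ i)) 1}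
    (hy : y ∈ U.eigenLine K (Φ i) σ) :
    U.pullC (U.pr4 K Φ i) 1 y ∈ (U.hodge (U.prod4 K Φ) 1).F (ind (Φ i) σ) :=
  h₃ _ _ (U.pr4 K Φ i) 1 (ind (Φ i) σ) ⟨y, U.eigenLine_le_F h₁₃ K (Φ i) σ hy, rfl⟩

/-- **Every Weil generator of the corner product of a face lies in `F² H⁴(P(f))`** (rfwf Lemma 1.2: the generator
`pr₀^*y₀ ∪ pr₁^*y₁ ∪ pr₂^*y₂ ∪ pr₃^*y₃` with all `yᵢ` of character `σ` lies in `F^{Σᵢ 1_{Φᵢ}(σ)} = F²`, by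
`Fact_cup2_hodge` and `sumTwo_corner`). [folklore] -/
theorem span_weilGenerators_le_F (h₃ : U.Fact_pull_hodge) (h₄ : U.Fact_cup2_hodge) (h₁₃ : U.Fact_alphaLine)
    (K : CMField) (f : Face K) :
    Submodule.span ℂ (U.weilGenerators K f.corner) ≤ (U.hodge (U.prod4 K f.corner) 4).F 2 := by
  rw [Submodule.span_le]
  rintro _ ⟨σ, y, hy, rfl⟩
  have h01 := h₄ _ 1 _ _ _ _ (U.pullC_pr4_mem_F h₃ h₁₃ K f.corner σ 0 (hy 0))
    (U.pullC_pr4_mem_F h₃ h₁₃ K f.corner σ 1 (hy 1))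
  have h23 := h₄ _ 1 _ _ _ _ (U.pullC_pr4_mem_F h₃ h₁₃ K f.corner σ 2 (hy 2))
    (U.pullC_pr4_mem_F h₃ h₁₃ K f.corner σ 3 (hy 3))
  have h := h₄ _ 2 _ _ _ _ h01 h23
  have hsum : ind (f.corner 0) σ + ind (f.corner 1) σ + (ind (f.corner 2) σ + ind (f.corner 3) σ) = 2 := by
    have := sumTwo_corner f σ; omega
  rw [hsum] at h
  exact h

/-- **rfwf Lemma 1.2 `lem:hodge22` for every geometric universe**: `Fact_weilLine_hodge` follows from
`Fact_pull_hodge`, `Fact_cup2_hodge` and `Fact_alphaLine` — the Weil line `W_K(P(f))` of the corner product of a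
face consists of rational Hodge classes of type `(2,2)`. [folklore] -/
theorem weilLine_hodge_of_facts (h₃ : U.Fact_pull_hodge) (h₄ : U.Fact_cup2_hodge) (h₁₃ : U.Fact_alphaLine) :
    U.Fact_weilLine_hodge := by
  intro K f x hx
  change x ∈ (U.hodge (U.prod4 K f.corner) (2 * 2)).hodgeClasses ((2 : ℕ) : ℤ)
  rw [mem_hodgeClasses_iff]
  exact U.span_weilGenerators_le_F h₃ h₄ h₁₃ K f hx

end Universe

end Summit.HodgeConjecture.CorCM

end
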